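import Literature.Probability.Percolation.MacroscopicInterfaceLoop
import HarnessLib

/-!
# Reversing a site-percolation interface loop: the interface loops of the complement configuration

Topic: Probability / Percolation. Proof-only companion of `InterfaceLoopPolygon.lean` (the crossed
darts `lv i → rv i`, side points and polygon `polyPt`/`polyPiece`/`polyTrace` of an interface loop
`IsSiteInterfaceLoop ω w` of critical site percolation on `δ𝕋`; F. Camia, C. M. Newman, Comm. Math.
Phys. 268 (2006), §2 and §4: cluster boundaries are loops of the hexagonal lattice "oriented in such
a way that" the open hexagons are on one prescribed side). The elementary **colour-reversal
symmetry** of that notion, which the tree did not record: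

* `IsSiteInterfaceLoop.reverse_compl` — **the reversed walk of an interface loop of `ω` is an
  interface loop of the complement configuration `ωᶜ`** (every dart is crossed the other way, so
  the closed site is now on the left: `triEdgeFaces_symm_holds`); `IsSiteInterfaceLoop.of_reverse_compl`
  — and conversely;
* `polyPt_reverse`, `polyPiece_reverse`, `polyTrace_reverse` — the polygon of the reversed walk has
  the same vertices in the opposite order, the same dart pieces and **the same trace**;
* `IsSiteInterfaceLoop.lv_reverse`, `IsSiteInterfaceLoop.rv_reverse` (and the side points
  `leftPt_reverse`, `rightPt_reverse`) — **the left site of step `i` of the reversed loop is the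
  right site of step `n - 1 - i` of the loop, and vice versa** (a dart of `𝕋` is determined by its
  pair of bordering faces, `eq_of_triEdgeFaces_eq`).

This is the device by which statements proved for the open (left) side of interface loops — e.g.
the open arms extracted from shell traversals in `LoopTraversalBound.lean` /
`LoopCrossingArms.lean` (Aizenman–Burchard, Duke Math. J. 99 (1999), App. A) — transfer to the
closed (right) side: apply them to `ωᶜ` and the reversed loops, whose traces, hence the planar
regions they cut out, are unchanged. Everything here is proved; no definitions and no named facts
are introduced.

## References

* F. Camia, C. M. Newman, Two-dimensional critical percolation: the full scaling limit, Comm. Math.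
  Phys. 268 (2006), §2, §4 [CamiaNewman2006].
* W. Werner, *Lectures on two-dimensional critical percolation*, IAS/Park City Math. Ser. 16 (2009),
  §1 (a dart and its two bordering faces) [WernerPCMI2009].

Mathlib: `SimpleGraph.Walk.reverse`, `SimpleGraph.Walk.getVert_reverse`,
`SimpleGraph.Walk.mem_darts_reverse`, `SimpleGraph.Walk.IsCycle.reverse`, `segment_symm`.
Tree: `IsSiteInterfaceLoop`, `IsSiteInterfaceLoop.dart_spec`, `eq_of_triEdgeFaces_eq`,
`triEdgeFaces_symm_holds`, `polyPt`, `polyPiece`, `polyTrace`, `IsSiteInterfaceLoop.leftPt/rightPt`.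
-/

noncomputable section

open Set

namespace Literature.Probability.Percolation

open LatticeModels

/-! ### The reversed loop is an interface loop of the complement -/

section Reverse

variable {ω : SiteConfig (Site 2)} {f₀ : HexVertex} {w : hexGraph.Walk f₀ f₀}

/-- **Reversal.** The reverse of an interface loop of `ω` (open sites on the left, closed sites on
the right of every dart) is an interface loop of `ωᶜ`: the reversed dart of `𝕋` has the two
bordering faces swapped (`triEdgeFaces_symm_holds`). [cite: CamiaNewman2006, §4] -/
theorem IsSiteInterfaceLoop.reverse_compl (hw : IsSiteInterfaceLoop ω w) :
    IsSiteInterfaceLoop ωᶜ w.reverse := by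
  refine ⟨hw.isCycle.reverse, fun d hd => ?_⟩
  rw [SimpleGraph.Walk.mem_darts_reverse] at hd
  obtain ⟨e, he, h1, h2⟩ := hw.2 _ hd
  refine ⟨e.symm, ?_, ?_, ?_⟩
  · rw [triEdgeFaces_symm_holds e, he]
    simp [SimpleGraph.Dart.symm, Prod.swap]
  · simpa [SimpleGraph.Dart.symm] using h2
  · simpa [SimpleGraph.Dart.symm] using h1

/-- **Conversely**, a closed walk whose reverse is an interface loop of `ωᶜ` is an interface loop
of `ω`. [cite: CamiaNewman2006, §4] -/
theorem IsSiteInterfaceLoop.of_reverse_compl (h : IsSiteInterfaceLoop ωᶜ w.reverse) :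
    IsSiteInterfaceLoop ω w := by
  have := h.reverse_compl
  rwa [compl_compl, SimpleGraph.Walk.reverse_reverse] at this

/-- An interface loop of `ω` is the same as a closed walk whose reverse is an interface loop of
`ωᶜ`. [cite: CamiaNewman2006, §4] -/
theorem isSiteInterfaceLoop_reverse_compl_iff :
    IsSiteInterfaceLoop ωᶜ w.reverse ↔ IsSiteInterfaceLoop ω w :=
  ⟨IsSiteInterfaceLoop.of_reverse_compl, IsSiteInterfaceLoop.reverse_compl⟩

end Reverse

/-! ### The polygon of the reversed walk -/

section Polygon

variable {f₀ g₀ : HexVertex} (δ : ℝ) (w : hexGraph.Walk f₀ g₀)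

/-- The vertices of the polygon of the reversed walk are those of the walk in the opposite order.
[folklore] -/
theorem polyPt_reverse (k : ℕ) : polyPt δ w.reverse k = polyPt δ w (w.length - k) := by
  simp [polyPt, SimpleGraph.Walk.getVert_reverse]

/-- The dart pieces of the polygon of the reversed walk are those of the walk in the opposite
order: piece `i` of the reverse is piece `n - 1 - i`. [folklore] -/
theorem polyPiece_reverse {i : ℕ} (hi : i < w.length) :
    polyPiece δ w.reverse i = polyPiece δ w (w.length - 1 - i) := by
  rw [polyPiece, polyPiece, polyPt_reverse, polyPt_reverse, segment_symm]
  have h1 : w.length - (i + 1) = w.length - 1 - i := by omega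
  have h2 : w.length - i = w.length - 1 - i + 1 := by omega
  rw [h1, h2]

/-- **The polygon of the reversed walk has the same trace.** [folklore] -/
theorem polyTrace_reverse : polyTrace δ w.reverse = polyTrace δ w := by
  ext z
  simp only [mem_polyTrace_iff, SimpleGraph.Walk.length_reverse]
  constructor
  · rintro ⟨i, hi, hz⟩
    exact ⟨w.length - 1 - i, by omega, by rwa [polyPiece_reverse δ w hi] at hz⟩
  · rintro ⟨i, hi, hz⟩
    refine ⟨w.length - 1 - i, by omega, ?_⟩
    rw [polyPiece_reverse δ w (by omega)]
    have : w.length - 1 - (w.length - 1 - i) = i := by omega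
    rwa [this]

end Polygon

/-! ### The crossed darts of the reversed loop -/

section Sides

variable {ω : SiteConfig (Site 2)} {f₀ : HexVertex} {w : hexGraph.Walk f₀ f₀}
  (hw : IsSiteInterfaceLoop ω w)

include hw

/-- **The crossed darts of the reversed loop are the reversed crossed darts**: for `i < n`, the
left site of step `i` of `w.reverse` (an open site of `ωᶜ`) is the right site of step `n - 1 - i`
of `w`, and the right site of step `i` of `w.reverse` is the left site of step `n - 1 - i` of `w`
(both darts have the pair of bordering faces `(F_{n-1-i}, F_{n-i})`, `eq_of_triEdgeFaces_eq`).
[cite: CamiaNewman2006, §4] -/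
theorem IsSiteInterfaceLoop.lv_rv_reverse {i : ℕ} (hi : i < w.length) :
    hw.reverse_compl.lv i = hw.rv (w.length - 1 - i) ∧
      hw.reverse_compl.rv i = hw.lv (w.length - 1 - i) := by
  have hi' : i < w.reverse.length := by rwa [SimpleGraph.Walk.length_reverse]
  have hj : w.length - 1 - i < w.length := by omega
  obtain ⟨h', hf', -, -⟩ := hw.reverse_compl.dart_spec hi'
  obtain ⟨h, hf, -, -⟩ := hw.dart_spec hj
  rw [SimpleGraph.Walk.getVert_reverse, SimpleGraph.Walk.getVert_reverse] at hf'
  have hsymm : triEdgeFaces (⟨(hw.rv (w.length - 1 - i), hw.lv (w.length - 1 - i)), h.symm⟩ : triGraph.Dart) =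
      (w.getVert (w.length - 1 - i), w.getVert (w.length - 1 - i + 1)) := by
    have := triEdgeFaces_symm_holds (⟨(hw.lv (w.length - 1 - i), hw.rv (w.length - 1 - i)), h⟩ : triGraph.Dart)
    rw [hf] at this
    simpa [SimpleGraph.Dart.symm] using this
  have e1 : w.length - (i + 1) = w.length - 1 - i := by omega
  have e2 : w.length - i = w.length - 1 - i + 1 := by omega
  rw [e1, e2] at hf'
  exact eq_of_triEdgeFaces_eq h' h.symm (hf'.trans hsymm.symm)

/-- The left site of step `i < n` of the reversed loop is the right site of step `n - 1 - i`.
[cite: CamiaNewman2006, §4] -/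
theorem IsSiteInterfaceLoop.lv_reverse {i : ℕ} (hi : i < w.length) :
    hw.reverse_compl.lv i = hw.rv (w.length - 1 - i) :=
  (hw.lv_rv_reverse hi).1

/-- The right site of step `i < n` of the reversed loop is the left site of step `n - 1 - i`.
[cite: CamiaNewman2006, §4] -/
theorem IsSiteInterfaceLoop.rv_reverse {i : ℕ} (hi : i < w.length) :
    hw.reverse_compl.rv i = hw.lv (w.length - 1 - i) :=
  (hw.lv_rv_reverse hi).2

/-- The left point at mesh `δ` of step `i < n` of the reversed loop is the right point of step
`n - 1 - i`. [folklore] -/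
theorem IsSiteInterfaceLoop.leftPt_reverse (δ : ℝ) {i : ℕ} (hi : i < w.length) :
    hw.reverse_compl.leftPt δ i = hw.rightPt δ (w.length - 1 - i) := by
  rw [IsSiteInterfaceLoop.leftPt, IsSiteInterfaceLoop.rightPt, hw.lv_reverse hi]

/-- The right point at mesh `δ` of step `i < n` of the reversed loop is the left point of step
`n - 1 - i`. [folklore] -/
theorem IsSiteInterfaceLoop.rightPt_reverse (δ : ℝ) {i : ℕ} (hi : i < w.length) :
    hw.reverse_compl.rightPt δ i = hw.leftPt δ (w.length - 1 - i) := by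
  rw [IsSiteInterfaceLoop.leftPt, IsSiteInterfaceLoop.rightPt, hw.rv_reverse hi]

end Sides

end Literature.Probability.Percolation
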